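import Mathlib
import Summits.Ventures.PercRepro2.TB14Slide
import Summits.Ventures.PercRepro2.TB14SlideKernels

/-!
# The mark slides along a degree-two vertex at the avoided root (typed BHK 1.3, single-vertex)
(blind cell PercRepro2, mine-c g17, 2026-08-25; `proofs/MINEC-TB14BLOCK.md` §11.4, Theorem K′)

`foldK13 ends a₁ a₂ x o = 1_Q(y) 1_Q(w) 1[x ∈ C_y(a₂)] (1[o ∈ C_y(a₂)] − 1[o ∈ C_w(a₂)])` is the typed BHK 1.3
kernel of the root `a₂` avoiding `a₁` for the single-vertex events `{x ∈ C₂}`, `{o ∈ C₂}`.  Let the mark `o`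
have exactly two edges `e₁ = o u` and `e₂ = o a₁` (to the AVOIDED root), both free.  In a colouring with
`e₂` open in a copy, `o ∈ C(a₂)` in that copy would connect `a₂` to `a₁`, so the copy's `1_Q` kills the
term; with `e₂` closed `o` is a leaf at `u` (or isolated).  Summing the four colourings
(`pairCount_foldK13_slide`):

  `S₁₃(G; a₂; x, o | a₁) = S₁₃(G − o; a₂; x, u | a₁)`

at every profile in which `e₁, e₂` are free — the (TB13) twin of Theorem K.  Exact check
`data/mine-c/g17/scripts/slide13.py` (3,000 / 3,000).  Own work; standard axioms.
-/

namespace Summit.Ventures.PercRepro2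

namespace TB14Cut

open CovForm A3InactiveTyped

section Slide13

variable {V : Type} {E : Type} [Fintype E] [DecidableEq E] {R : Type*} [Field R]
variable {ends : E → Sym2 V} {e₁ e₂ : E} {o u a₁ a₂ x : V}

omit [Fintype E] [DecidableEq E] in
/-- `foldK13` vanishes when the first copy connects the roots. -/
lemma foldK13_eq_zero_of_conn_y {y w : Config E} (h : Conn ends y a₁ a₂) :
    (foldK13 ends a₁ a₂ x o y w : R) = 0 := by
  classical
  simp [foldK13, iQ_eq_ite', h]

omit [Fintype E] [DecidableEq E] in
/-- `foldK13` vanishes when the second copy connects the roots. -/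
lemma foldK13_eq_zero_of_conn_w {y w : Config E} (h : Conn ends w a₁ a₂) :
    (foldK13 ends a₁ a₂ x o y w : R) = 0 := by
  classical
  simp [foldK13, iQ_eq_ite', h]

omit [Fintype E] [DecidableEq E] in
/-- `foldK13` vanishes when `o` is in the cluster of `a₂` in neither copy. -/
lemma foldK13_eq_zero_of_not_conn {y w : Config E} (hy : ¬ Conn ends y a₂ o)
    (hw : ¬ Conn ends w a₂ o) : (foldK13 ends a₁ a₂ x o y w : R) = 0 := by
  classical
  simp [foldK13, iH_eq_ite', hy, hw]

omit [Fintype E] [DecidableEq E] in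
/-- With an open edge `o a₁` in the first copy, the term vanishes (`o ∈ C_y(a₂)` would give
`a₁ ↔ a₂`), unless `o` is connected to `a₂` in the second copy alone. -/
lemma foldK13_of_open_y {y w : Config E} (h₂ : ends e₂ = s(o, a₁)) (hy : y e₂ = true)
    (hw : ¬ Conn ends w a₂ o) : (foldK13 ends a₁ a₂ x o y w : R) = 0 := by
  classical
  by_cases hc : Conn ends y a₂ o
  · exact foldK13_eq_zero_of_conn_y (conn_symm (conn_trans hc (conn_of_openAdj ⟨e₂, hy, h₂⟩)))
  · exact foldK13_eq_zero_of_not_conn hc hw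

omit [Fintype E] [DecidableEq E] in
/-- With an open edge `o a₁` in the second copy, the term vanishes unless `o` is connected to `a₂`
in the first copy alone. -/
lemma foldK13_of_open_w {y w : Config E} (h₂ : ends e₂ = s(o, a₁)) (hw : w e₂ = true)
    (hy : ¬ Conn ends y a₂ o) : (foldK13 ends a₁ a₂ x o y w : R) = 0 := by
  classical
  by_cases hc : Conn ends w a₂ o
  · exact foldK13_eq_zero_of_conn_w (conn_symm (conn_trans hc (conn_of_openAdj ⟨e₂, hw, h₂⟩)))
  · exact foldK13_eq_zero_of_not_conn hy hc

/-- **The (TB13) mark slides along a degree-two vertex at the avoided root** (THEOREM K′): if the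
mark `o` has exactly the two free edges `e₁ = o u` and `e₂ = o a₁`, then the two-copy count of the
typed BHK 1.3 kernel equals the count with both edges closed and the mark moved to `u`. -/
theorem pairCount_foldK13_slide (he : e₁ ≠ e₂) (h₁ : ends e₁ = s(o, u)) (h₂ : ends e₂ = s(o, a₁))
    (hou : o ≠ u) (hoa₁ : o ≠ a₁) (ho : ∀ f, o ∈ ends f → f = e₁ ∨ f = e₂)
    (ha₂ : a₂ ≠ o) (hx : x ≠ o) (F : Finset E) (z : Config E) (h₁F : e₁ ∈ F) (h₂F : e₂ ∈ F) :
    pairCount F z (foldK13 ends a₁ a₂ x o : Config E → Config E → R) =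
      pairCount ((F.erase e₂).erase e₁) (Function.update (Function.update z e₂ false) e₁ false)
        (foldK13 ends a₁ a₂ x u) := by
  classical
  set F' := F.erase e₂ with hF'
  set z' := Function.update z e₂ false with hz'
  set F'' := F'.erase e₁ with hF''
  set z'' := Function.update z' e₁ false with hz''
  have h₁F' : e₁ ∈ F' := Finset.mem_erase.2 ⟨he, h₁F⟩
  have ho₁ : ∀ f, o ∈ ends f → f ≠ e₁ → f = e₂ := fun f hf hf₁ => (ho f hf).resolve_left hf₁
  have ho₂ : ∀ f, o ∈ ends f → f ≠ e₂ → f = e₁ := fun f hf hf₂ => (ho f hf).resolve_right hf₂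
  have ha₁o : a₁ ≠ o := hoa₁.symm
  have hflip_off : ∀ (y : Config E) (f : E), f ≠ e₁ → f ≠ e₂ →
      A3InactiveTyped.flipOn F y f = A3InactiveTyped.flipOn F'' y f := by
    intro y f hf₁ hf₂
    by_cases hfF : f ∈ F
    · rw [A3InactiveTyped.flipOn_of_mem hfF,
        A3InactiveTyped.flipOn_of_mem (Finset.mem_erase.2 ⟨hf₁, Finset.mem_erase.2 ⟨hf₂, hfF⟩⟩)]
    · rw [A3InactiveTyped.flipOn_of_notMem hfF,
        A3InactiveTyped.flipOn_of_notMem (fun h => hfF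
          (Finset.mem_of_mem_erase (Finset.mem_of_mem_erase h)))]
  have hflip''₁ : ∀ y : Config E, A3InactiveTyped.flipOn F'' y e₁ = y e₁ := fun y =>
    A3InactiveTyped.flipOn_of_notMem (Finset.notMem_erase e₁ F')
  have hflip''₂ : ∀ y : Config E, A3InactiveTyped.flipOn F'' y e₂ = y e₂ := fun y =>
    A3InactiveTyped.flipOn_of_notMem (fun h => Finset.notMem_erase e₂ F (Finset.mem_of_mem_erase h))
  unfold pairCount
  rw [sum_admissible_split h₂F, ← hF', ← hz', sum_admissible_split h₁F', ← hF'', ← hz'']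
  refine Finset.sum_congr rfl fun y₂ _ => ?_
  by_cases hadm : ∀ f, f ∉ F'' → y₂ f = z'' f
  · rw [if_pos hadm, if_pos hadm]
    have hy₂₁ : y₂ e₁ = false := by
      have := hadm e₁ (Finset.notMem_erase e₁ F')
      rwa [hz'', Function.update_self] at this
    have hy₂₂ : y₂ e₂ = false := by
      have := hadm e₂ (fun h => Finset.notMem_erase e₂ F (Finset.mem_of_mem_erase h))
      rwa [hz'', Function.update_of_ne he.symm, hz', Function.update_self] at this
    have hiso : ∀ f, o ∈ ends f → y₂ f = false := by
      intro f hf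
      rcases ho f hf with rfl | rfl
      · exact hy₂₁
      · exact hy₂₂
    have hself₁ : Function.update y₂ e₁ false = y₂ := by
      rw [← hy₂₁]; exact Function.update_eq_self e₁ y₂
    have hself₂ : Function.update y₂ e₂ false = y₂ := by
      rw [← hy₂₂]; exact Function.update_eq_self e₂ y₂
    have hself₂' : Function.update (Function.update y₂ e₁ true) e₂ false =
        Function.update y₂ e₁ true := by
      have : Function.update y₂ e₁ true e₂ = false := by
        rw [Function.update_of_ne he.symm]; exact hy₂₂
      rw [← this]; exact Function.update_eq_self e₂ _
    rw [hself₁, hself₂, hself₂']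
    set w₂ := A3InactiveTyped.flipOn F'' y₂ with hw₂
    -- (A) both closed in the first copy (both open in the second): `o` isolated in `y`, `o – a₁`
    -- open in `w`
    have hA : (foldK13 ends a₁ a₂ x o y₂ (A3InactiveTyped.flipOn F y₂) : R) = 0 := by
      refine foldK13_of_open_w h₂ ?_ (not_conn_isolated hiso ha₂)
      rw [A3InactiveTyped.flipOn_of_mem h₂F, hy₂₂]; rfl
    -- (D) both open in the first copy: `o – a₁` open in `y`, `o` isolated in `w`
    have hD : (foldK13 ends a₁ a₂ x o (Function.update (Function.update y₂ e₁ true) e₂ true)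
        (A3InactiveTyped.flipOn F (Function.update (Function.update y₂ e₁ true) e₂ true)) : R) =
        0 := by
      refine foldK13_of_open_y h₂ (Function.update_self _ _ _) (not_conn_isolated ?_ ha₂)
      intro f hf
      rcases ho f hf with rfl | rfl
      · rw [A3InactiveTyped.flipOn_of_mem h₁F, Function.update_of_ne he, Function.update_self]; rfl
      · rw [A3InactiveTyped.flipOn_of_mem h₂F, Function.update_self]; rfl
    -- (B) `e₁` closed, `e₂` open in the first copy: `o` a leaf at `a₁` in `y`, a leaf at `u` in `w`
    -- (C) `e₁` open, `e₂` closed in the first copy: `o` a leaf at `u` in `y`, a leaf at `a₁` in `w`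
    -- both are evaluated by the leaf rule; their sum is the kernel of the mark `u` on `G − o`
    have hB : (foldK13 ends a₁ a₂ x o (Function.update y₂ e₂ true)
        (A3InactiveTyped.flipOn F (Function.update y₂ e₂ true)) : R) =
        iQ ends a₁ a₂ y₂ * iQ ends a₁ a₂ w₂ * iH ends a₂ x y₂ *
          (0 - iH ends a₂ u w₂) := by
      set y := Function.update y₂ e₂ true with hy
      set w := A3InactiveTyped.flipOn F y with hw
      have hy₂ : y e₂ = true := Function.update_self _ _ _
      have hy₁ : y e₁ = false := by rw [hy, Function.update_of_ne he]; exact hy₂₁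
      have hyback : Function.update y e₂ false = y₂ := by
        rw [hy, Function.update_idem, ← hy₂₂]; exact Function.update_eq_self e₂ y₂
      have hleafy : ∀ f, o ∈ ends f → f ≠ e₂ → y f = false := by
        intro f hf hf₂
        rw [ho₂ f hf hf₂]; exact hy₁
      have hw₁ : w e₁ = true := by
        rw [hw, A3InactiveTyped.flipOn_of_mem h₁F, hy₁]; rfl
      have hw₂' : w e₂ = false := by
        rw [hw, A3InactiveTyped.flipOn_of_mem h₂F, hy₂]; rfl
      have hleafw : ∀ f, o ∈ ends f → f ≠ e₁ → w f = false := by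
        intro f hf hf₁
        rw [ho₁ f hf hf₁]; exact hw₂'
      have hwback : Function.update w e₁ false = w₂ := by
        funext f
        by_cases hf₁ : f = e₁
        · subst hf₁
          rw [Function.update_self, hw₂, hflip''₁]; exact hy₂₁.symm
        by_cases hf₂ : f = e₂
        · subst hf₂
          rw [Function.update_of_ne hf₁, hw₂', hw₂, hflip''₂]; exact hy₂₂.symm
        · rw [Function.update_of_ne hf₁, hw, hw₂, hflip_off y f hf₁ hf₂]
          by_cases hfF : f ∈ F''
          · rw [A3InactiveTyped.flipOn_of_mem hfF, A3InactiveTyped.flipOn_of_mem hfF, hy,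
              Function.update_of_ne hf₂]
          · rw [A3InactiveTyped.flipOn_of_notMem hfF, A3InactiveTyped.flipOn_of_notMem hfF, hy,
              Function.update_of_ne hf₂]
      -- connections in `y` off `o`, and `o`'s own: `o ↔ a₁` in `y`
      have hQy : Conn ends y a₁ a₂ ↔ Conn ends y₂ a₁ a₂ := by
        rw [conn_leaf_erase h₂ hoa₁ hleafy hy₂ ha₁o ha₂, hyback]
      have hXy : Conn ends y a₂ x ↔ Conn ends y₂ a₂ x := by
        rw [conn_leaf_erase h₂ hoa₁ hleafy hy₂ ha₂ hx, hyback]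
      have hOy : Conn ends y a₂ o ↔ Conn ends y₂ a₂ a₁ := by
        have hadj : Conn ends y o a₁ := conn_of_openAdj ⟨e₂, hy₂, h₂⟩
        have h1 : Conn ends y a₂ o ↔ Conn ends y a₂ a₁ :=
          ⟨fun h => conn_trans h hadj, fun h => conn_trans h (conn_symm hadj)⟩
        rw [h1, conn_leaf_erase h₂ hoa₁ hleafy hy₂ ha₂ ha₁o, hyback]
      have hQw : Conn ends w a₁ a₂ ↔ Conn ends w₂ a₁ a₂ := by
        rw [conn_leaf_erase h₁ hou hleafw hw₁ ha₁o ha₂, hwback]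
      have hOw : Conn ends w a₂ o ↔ Conn ends w₂ a₂ u := by
        rw [conn_mark_leaf h₁ hou hleafw hw₁ ha₂, hwback]
      simp only [foldK13, iQ_eq_ite', iH_eq_ite', hQy, hXy, hOy, hQw, hOw]
      by_cases hq : Conn ends y₂ a₁ a₂
      · rw [if_pos hq]; ring
      · rw [if_neg hq, if_neg (fun h => hq (conn_symm h))]
        try ring
    have hC : (foldK13 ends a₁ a₂ x o (Function.update y₂ e₁ true)
        (A3InactiveTyped.flipOn F (Function.update y₂ e₁ true)) : R) =
        iQ ends a₁ a₂ y₂ * iQ ends a₁ a₂ w₂ * iH ends a₂ x y₂ *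
          (iH ends a₂ u y₂ - 0) := by
      set y := Function.update y₂ e₁ true with hy
      set w := A3InactiveTyped.flipOn F y with hw
      have hy₁ : y e₁ = true := Function.update_self _ _ _
      have hy₂ : y e₂ = false := by rw [hy, Function.update_of_ne he.symm]; exact hy₂₂
      have hyback : Function.update y e₁ false = y₂ := by
        rw [hy, Function.update_idem, ← hy₂₁]; exact Function.update_eq_self e₁ y₂
      have hleafy : ∀ f, o ∈ ends f → f ≠ e₁ → y f = false := by
        intro f hf hf₁
        rw [ho₁ f hf hf₁]; exact hy₂
      have hw₁ : w e₁ = false := by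
        rw [hw, A3InactiveTyped.flipOn_of_mem h₁F, hy₁]; rfl
      have hw₂' : w e₂ = true := by
        rw [hw, A3InactiveTyped.flipOn_of_mem h₂F, hy₂]; rfl
      have hleafw : ∀ f, o ∈ ends f → f ≠ e₂ → w f = false := by
        intro f hf hf₂
        rw [ho₂ f hf hf₂]; exact hw₁
      have hwback : Function.update w e₂ false = w₂ := by
        funext f
        by_cases hf₂ : f = e₂
        · subst hf₂
          rw [Function.update_self, hw₂, hflip''₂]; exact hy₂₂.symm
        by_cases hf₁ : f = e₁
        · subst hf₁
          rw [Function.update_of_ne hf₂, hw₁, hw₂, hflip''₁]; exact hy₂₁.symm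
        · rw [Function.update_of_ne hf₂, hw, hw₂, hflip_off y f hf₁ hf₂]
          by_cases hfF : f ∈ F''
          · rw [A3InactiveTyped.flipOn_of_mem hfF, A3InactiveTyped.flipOn_of_mem hfF, hy,
              Function.update_of_ne hf₁]
          · rw [A3InactiveTyped.flipOn_of_notMem hfF, A3InactiveTyped.flipOn_of_notMem hfF, hy,
              Function.update_of_ne hf₁]
      have hQy : Conn ends y a₁ a₂ ↔ Conn ends y₂ a₁ a₂ := by
        rw [conn_leaf_erase h₁ hou hleafy hy₁ ha₁o ha₂, hyback]
      have hXy : Conn ends y a₂ x ↔ Conn ends y₂ a₂ x := by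
        rw [conn_leaf_erase h₁ hou hleafy hy₁ ha₂ hx, hyback]
      have hOy : Conn ends y a₂ o ↔ Conn ends y₂ a₂ u := by
        rw [conn_mark_leaf h₁ hou hleafy hy₁ ha₂, hyback]
      have hQw : Conn ends w a₁ a₂ ↔ Conn ends w₂ a₁ a₂ := by
        rw [conn_leaf_erase h₂ hoa₁ hleafw hw₂' ha₁o ha₂, hwback]
      have hOw : Conn ends w a₂ o ↔ Conn ends w₂ a₂ a₁ := by
        have hadj : Conn ends w o a₁ := conn_of_openAdj ⟨e₂, hw₂', h₂⟩
        have h1 : Conn ends w a₂ o ↔ Conn ends w a₂ a₁ :=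
          ⟨fun h => conn_trans h hadj, fun h => conn_trans h (conn_symm hadj)⟩
        rw [h1, conn_leaf_erase h₂ hoa₁ hleafw hw₂' ha₂ ha₁o, hwback]
      simp only [foldK13, iQ_eq_ite', iH_eq_ite', hQy, hXy, hOy, hQw, hOw]
      by_cases hq : Conn ends w₂ a₁ a₂
      · rw [if_pos hq]; ring
      · rw [if_neg hq, if_neg (fun h => hq (conn_symm h))]
        try ring
    rw [hA, hB, hC, hD]
    simp only [foldK13, hw₂]
    ring
  · rw [if_neg hadm, if_neg hadm]

end Slide13

end TB14Cut

end Summit.Ventures.PercRepro2
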